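import Literature.MathematicalPhysics.QuantumLattice.HubbardTTPrimeThermalPressureLimit
import HarnessLib

/-!
# The β-STAIRCASE on the thermal pressure NUMBER `p(β; t,t',U; n)`: N-step floors from energy caps, N-step
# ceilings from energy floors, and the certificate-free infinite-temperature anchor

Topic `MathematicalPhysics/QuantumLattice` (family `hubbard`; the `f⁺` input protocol of the `T > 0` entropy rows,
CERT-THERMAL §9 (d)). Companion of `TorusSectorPressureStaircase.lean` / `TorusSectorPressureZeroAnchor.lean`
(hubbard-thermal p1: the staircase in the EVENTUAL per-volume `hW` / `hu` shapes along a side sequence) and of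
`HubbardTTPrimeThermalPressureLimit.lean` (hubbard-box p1: the thermal pressure
`ThermodynamicLimit.pressureTT' β t t' U n` exists as a limit; the ONE-STEP staircase on the number
`pressureTT'_sub_mul_le_pressureTT'`, `pressureTT'_le_pressureTT'_sub_mul`; `pressureTT'_zero`).

For `U ≥ 0`, `0 ≤ n < 2`, a monotone grid `0 ≤ b 0 ≤ b 1 ≤ …` and certified ENERGY CAPS `e⁺_i` valid for every
torus-limit Gibbs state at `b i` (`i < N`):

* `pressureTT'_staircase_floor`: `p(b 0) − Σ_{i<N} (b(i+1) − b i)·e⁺_i ≤ p(b N)` (telescoped supporting lines of the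
  convex `β ↦ p(β)`: the left Riemann sum of `p(b_N) = p(b_0) − ∫ e dβ` with the antitone `e`);
* `sub_sum_le_pressureTT'_of_le`: the same from any floor `W₀ ≤ p(b 0)` — the ROW `W₀ − Σ Δ_i e⁺_i ≤ pressureTT' (b N)`
  consumed by `…_of_le_pressureTT'` entropy rows (`TorusSectorGibbsEntropyRowPressureNumber.lean`);
* `binEntropy_sub_sum_le_pressureTT'`: the CERTIFICATE-FREE anchor `b 0 = 0`, `W₀ = p(0) = 2 H_b(n/2)`;
* duals `pressureTT'_staircase_ceiling`, `pressureTT'_le_sub_sum_of_le`: energy FLOORS `e⁻_{i+1}` at the colder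
  ends `b(i+1)` give `p(b N) ≤ p(b 0) − Σ_{i<N} (b(i+1) − b i)·e⁻_{i+1} ≤ u₀ − Σ …` for any ceiling `p(b 0) ≤ u₀`.

Everything is PROVED (induction on `N` over the one-step lemmas); no definition, no named fact.

References: Gustafson–Sigal 2011 §18.3 (convexity of `log Z` in `β`, variational principle) [cite: GustafsonSigal2003, §18.3];
Israel 1979 Thm. I.2.4 / Lemma II.3.1 [cite: Israel1979, Lemma II.3.1]; Cover–Thomas Thm. 11.1.3 (`#sector`,
the `β = 0` value) [cite: CoverThomas2006, Theorem 11.1.3].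
-/

noncomputable section

namespace Literature.MathematicalPhysics.QuantumLattice

open Matrix Finset HubbardWave0 Literature.Probability.LatticeModels
open _root_.Filter
open scoped _root_.Topology ComplexOrder BigOperators

namespace ThermodynamicLimit

section Staircase

variable (t t' : ℝ) {U : ℝ} (hU : 0 ≤ U) {n : ℝ} (hn0 : 0 ≤ n) (hn2 : n < 2)
include hU hn0 hn2

/-- **N-step β-staircase FLOOR on the number.** `0 ≤ b 0`, `b` monotone, caps `e_Φ(ω) ≤ e⁺_i` on every torus
limit of the canonical sector Gibbs states at `b i` (`i < N`) ⟹ `p(b 0) − Σ_{i<N} (b(i+1) − b i)·e⁺_i ≤ p(b N)`.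
[cite: GustafsonSigal2003, §18.3] [cite: Israel1979, Lemma II.3.1] -/
theorem pressureTT'_staircase_floor {b : ℕ → ℝ} (hb0 : 0 ≤ b 0) (hb : Monotone b) {ecap : ℕ → ℝ} (N : ℕ)
    (hcap : ∀ i < N, ∀ (ω : InfVolFermionState 2) (Ls : ℕ → ℕ), Tendsto Ls atTop atTop →
      ω.IsTorusLimitOfMixture (sectorGibbsCount n) (fun L => sectorGibbsWeightTT' (b i) t t' U n L)
        (fun L => sectorGibbsVectorTT' t t' U n L) Ls →
      ω.meanEnergy (hubbardTTPrimeFermionInteraction t t' U) 1 ≤ ecap i) :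
    pressureTT' (b 0) t t' U n - ∑ i ∈ Finset.range N, (b (i + 1) - b i) * ecap i ≤ pressureTT' (b N) t t' U n := by
  induction N with
  | zero => simp
  | succ N ih =>
    have h1 := ih fun i hi => hcap i (Nat.lt_succ_of_lt hi)
    have h2 := pressureTT'_sub_mul_le_pressureTT' hn0 hn2 t t' hU (hb0.trans (hb (Nat.zero_le N)))
      (hb (Nat.le_succ N)) (hcap N (Nat.lt_succ_self N))
    rw [Finset.sum_range_succ]
    linarith

/-- **The staircase floor as a ROW on the number**: any floor `W₀ ≤ p(b 0)` (C2 / purity box / an earlier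
staircase) and caps `e⁺_i` (`i < N`) give `W₀ − Σ_{i<N} (b(i+1) − b i)·e⁺_i ≤ pressureTT' (b N) t t' U n` — the input
`hW` of the entropy rows `…_of_le_pressureTT'` at `β = b N`, i.e. `f⁺(b N) = (Σ Δ_i e⁺_i − W₀)/b N`.
[cite: GustafsonSigal2003, §18.3] [cite: Israel1979, Lemma II.3.1] -/
theorem sub_sum_le_pressureTT'_of_le {b : ℕ → ℝ} (hb0 : 0 ≤ b 0) (hb : Monotone b) {ecap : ℕ → ℝ} (N : ℕ)
    (hcap : ∀ i < N, ∀ (ω : InfVolFermionState 2) (Ls : ℕ → ℕ), Tendsto Ls atTop atTop →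
      ω.IsTorusLimitOfMixture (sectorGibbsCount n) (fun L => sectorGibbsWeightTT' (b i) t t' U n L)
        (fun L => sectorGibbsVectorTT' t t' U n L) Ls →
      ω.meanEnergy (hubbardTTPrimeFermionInteraction t t' U) 1 ≤ ecap i)
    {W₀ : ℝ} (hW₀ : W₀ ≤ pressureTT' (b 0) t t' U n) :
    W₀ - ∑ i ∈ Finset.range N, (b (i + 1) - b i) * ecap i ≤ pressureTT' (b N) t t' U n := by
  have h := pressureTT'_staircase_floor t t' hU hn0 hn2 hb0 hb N hcap
  linarith

/-- **The certificate-free infinite-temperature anchor on the number**: `b 0 = 0` (so `p(b 0) = 2 H_b(n/2)`,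
`pressureTT'_zero`) and caps `e⁺_i` (`i < N`; at `i = 0` the cap at `β = 0`) give
`2 H_b(n/2) − Σ_{i<N} (b(i+1) − b i)·e⁺_i ≤ pressureTT' (b N) t t' U n`. [cite: CoverThomas2006, Theorem 11.1.3]
[cite: GustafsonSigal2003, §18.3] -/
theorem binEntropy_sub_sum_le_pressureTT' {b : ℕ → ℝ} (hb00 : b 0 = 0) (hb : Monotone b) {ecap : ℕ → ℝ} (N : ℕ)
    (hcap : ∀ i < N, ∀ (ω : InfVolFermionState 2) (Ls : ℕ → ℕ), Tendsto Ls atTop atTop →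
      ω.IsTorusLimitOfMixture (sectorGibbsCount n) (fun L => sectorGibbsWeightTT' (b i) t t' U n L)
        (fun L => sectorGibbsVectorTT' t t' U n L) Ls →
      ω.meanEnergy (hubbardTTPrimeFermionInteraction t t' U) 1 ≤ ecap i) :
    2 * Real.binEntropy (n / 2) - ∑ i ∈ Finset.range N, (b (i + 1) - b i) * ecap i ≤ pressureTT' (b N) t t' U n := by
  have h := pressureTT'_staircase_floor t t' hU hn0 hn2 (le_of_eq hb00.symm) hb N hcap
  rw [hb00, pressureTT'_zero t t' hU hn0 hn2] at h
  exact h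

/-- **N-step β-staircase CEILING on the number.** `0 ≤ b 0`, `b` monotone, energy FLOORS `e⁻_{i+1} ≤ e_Φ(ω)` on every
torus limit at the colder ends `b(i+1)` (`i < N`) ⟹ `p(b N) ≤ p(b 0) − Σ_{i<N} (b(i+1) − b i)·e⁻_{i+1}`.
[cite: GustafsonSigal2003, §18.3] [cite: Israel1979, Lemma II.3.1] -/
theorem pressureTT'_staircase_ceiling {b : ℕ → ℝ} (hb0 : 0 ≤ b 0) (hb : Monotone b) {efl : ℕ → ℝ} (N : ℕ)
    (hfloor : ∀ i < N, ∀ (ω : InfVolFermionState 2) (Ls : ℕ → ℕ), Tendsto Ls atTop atTop →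
      ω.IsTorusLimitOfMixture (sectorGibbsCount n) (fun L => sectorGibbsWeightTT' (b (i + 1)) t t' U n L)
        (fun L => sectorGibbsVectorTT' t t' U n L) Ls →
      efl (i + 1) ≤ ω.meanEnergy (hubbardTTPrimeFermionInteraction t t' U) 1) :
    pressureTT' (b N) t t' U n ≤ pressureTT' (b 0) t t' U n - ∑ i ∈ Finset.range N, (b (i + 1) - b i) * efl (i + 1) := by
  induction N with
  | zero => simp
  | succ N ih =>
    have h1 := ih fun i hi => hfloor i (Nat.lt_succ_of_lt hi)
    have h2 := pressureTT'_le_pressureTT'_sub_mul hn0 hn2 t t' hU (hb0.trans (hb (Nat.zero_le N)))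
      (hb (Nat.le_succ N)) (hfloor N (Nat.lt_succ_self N))
    rw [Finset.sum_range_succ]
    linarith

/-- **The staircase ceiling as a ROW on the number**: a ceiling `p(b 0) ≤ u₀` (Markov / cluster anchor at the hot
end) and floors `e⁻_{i+1}` give `pressureTT' (b N) t t' U n ≤ u₀ − Σ_{i<N} (b(i+1) − b i)·e⁻_{i+1}` — the `hu` input of
the cold chords. [cite: GustafsonSigal2003, §18.3] [cite: Israel1979, Lemma II.3.1] -/
theorem pressureTT'_le_sub_sum_of_le {b : ℕ → ℝ} (hb0 : 0 ≤ b 0) (hb : Monotone b) {efl : ℕ → ℝ} (N : ℕ)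
    (hfloor : ∀ i < N, ∀ (ω : InfVolFermionState 2) (Ls : ℕ → ℕ), Tendsto Ls atTop atTop →
      ω.IsTorusLimitOfMixture (sectorGibbsCount n) (fun L => sectorGibbsWeightTT' (b (i + 1)) t t' U n L)
        (fun L => sectorGibbsVectorTT' t t' U n L) Ls →
      efl (i + 1) ≤ ω.meanEnergy (hubbardTTPrimeFermionInteraction t t' U) 1)
    {u₀ : ℝ} (hu₀ : pressureTT' (b 0) t t' U n ≤ u₀) :
    pressureTT' (b N) t t' U n ≤ u₀ - ∑ i ∈ Finset.range N, (b (i + 1) - b i) * efl (i + 1) := by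
  have h := pressureTT'_staircase_ceiling t t' hU hn0 hn2 hb0 hb N hfloor
  linarith

/-- **Infinite-temperature ceiling anchor**: `b 0 = 0` ⟹ `pressureTT' (b N) ≤ 2 H_b(n/2) − Σ_{i<N} (b(i+1) − b i)·e⁻_{i+1}`
(certificate-free hot end; the floors `e⁻` are e.g. the `T = 0` relaxation floor at every `β`).
[cite: CoverThomas2006, Theorem 11.1.3] [cite: GustafsonSigal2003, §18.3] -/
theorem pressureTT'_le_binEntropy_sub_sum {b : ℕ → ℝ} (hb00 : b 0 = 0) (hb : Monotone b) {efl : ℕ → ℝ} (N : ℕ)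
    (hfloor : ∀ i < N, ∀ (ω : InfVolFermionState 2) (Ls : ℕ → ℕ), Tendsto Ls atTop atTop →
      ω.IsTorusLimitOfMixture (sectorGibbsCount n) (fun L => sectorGibbsWeightTT' (b (i + 1)) t t' U n L)
        (fun L => sectorGibbsVectorTT' t t' U n L) Ls →
      efl (i + 1) ≤ ω.meanEnergy (hubbardTTPrimeFermionInteraction t t' U) 1) :
    pressureTT' (b N) t t' U n ≤ 2 * Real.binEntropy (n / 2) - ∑ i ∈ Finset.range N, (b (i + 1) - b i) * efl (i + 1) := by
  have h := pressureTT'_staircase_ceiling t t' hU hn0 hn2 (le_of_eq hb00.symm) hb N hfloor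
  rw [hb00, pressureTT'_zero t t' hU hn0 hn2] at h
  exact h

end Staircase

end ThermodynamicLimit

end Literature.MathematicalPhysics.QuantumLattice

end
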